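import Summits.CriticalPhenomena.Ising3DConformalLimit.Theses.EnergyNotSigmaSquared
import Summits.CriticalPhenomena.Ising3DConformalLimit.Theorems.EnergyNotSigmaSquaredGapForcesFarMergingEnergyFactorisation
import Summits.CriticalPhenomena.Ising3DConformalLimit.Theorems.EnergyNotSigmaSquaredGapForcesFarMergingUnpinchedEnvelope
import Summits.CriticalPhenomena.Ising3DConformalLimit.Theorems.MoebiusLimitExists.Negative.PinnedClusterPoints
import Literature.Probability.LatticeModels.ImprovedTreeDiagramBoundProofs

/-!
# `EnergyGapSoft` is adjacent sourced-current merging (item stmt-CriticalPhenomena-4473)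

Route `EnergyNotSigmaSquared`, support item `EnergyGapSoft` ("ε ≠ :σ²: on ℤ³", soft form):
`⟨σ₀σ_{e₂} ; σ_xσ_{x+e₂}⟩_{β_c} ≤ ε ⟨σ₀σ_x⟩²_{β_c}` for `‖x‖ ≥ R(ε)`.

For the critical nearest-neighbour Ising model on `ℤ³` write `G = criticalTwoPoint 3`,
`T(x) = ⟨σ₀σ_{e₂}σ_xσ_{x+e₂}⟩ - ⟨σ₀σ_{e₂}⟩⟨σ_xσ_{x+e₂}⟩` and, for the infinite-volume sourced double
random current `P^{A,B}_{β_c} = sourcedDoubleCurrentLawInf 3 (criticalBeta 3) A B`,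

* `A_par(x)   = 1 - P^{{0}∆{x},{e₂}∆{x+e₂}}_{β_c}[0 ↔ e₂]` (parallel pairing: the current from `0` to
  `x` and the current from `e₂` to `x + e₂` do not merge),
* `A_cross(x) = 1 - P^{{0}∆{x+e₂},{e₂}∆{x}}_{β_c}[0 ↔ e₂]` (crossed pairing).

This file proves, unconditionally:

* `adjacentTruncation_eq` — `T(x) = G(x)² A_par(x) + G(x+e₂) G(x-e₂) A_cross(x)` (the tree's
  `energyFactorisation_criticalCorr`, Aizenman's switching identity ADC21 (3.11) averaged over the
  two cross pairings, with the pair correlators rewritten by translation invariance);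
* `adjacentTruncation_le` — the `κ = 0` envelope `0 ≤ T(x) ≤ (1 + G(e₂)⁻²) G(x)²` for all `x`
  (GKS II; Lebowitz; GKS II on pairs `G(x)G(e₂) ≤ G(x ± e₂) ≤ G(x)/G(e₂)`), i.e. `EnergyGapSoft` with
  `ε` frozen at a constant is a theorem, so the whole content of the item is the decay `ε → 0`;
* `energyGapSoft_iff_adjacentMerging` — **`EnergyGapSoft` holds iff both adjacent avoidance
  probabilities tend to zero**: `∀ ε > 0, ∃ R, ∀ x, R ≤ ‖x‖ → A_par(x) ≤ ε ∧ A_cross(x) ≤ ε`, i.e.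
  iff two independent critical sourced currents leaving the adjacent sources `0, e₂` towards the
  adjacent far targets merge (`0 ↔ e₂` in `n̂₁ ∪ n̂₂`) with probability `→ 1` as the targets recede,
  for both pairings of the targets.

No definition is introduced; nothing here asserts the item (whose decay statement is not known in
print: Lebowitz' inequality gives `κ = 0` only).

## References

* M. Aizenman, H. Duminil-Copin, Ann. of Math. 194 (2021), §3.2, eqs. (3.10)–(3.12)
  [AizenmanDuminilCopinAnnals2021].
* M. Aizenman, Comm. Math. Phys. 86 (1982) 1–48, Prop. 5.2 [AizenmanCMP1982].
* J. L. Lebowitz, Comm. Math. Phys. 35 (1974) 87–92, eq. (2.5b) [Lebowitz1974].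
* S. Friedli, Y. Velenik, *Statistical Mechanics of Lattice Systems* (CUP 2017), Thm. 3.20
  [FriedliVelenik2017].
-/

noncomputable section

namespace Summit.CriticalPhenomena.Ising3DConformalLimit.EnergyNotSigmaSquaredEnergyGapSoft

open scoped symmDiff
open MeasureTheory
open Literature.Probability.LatticeModels Literature.Probability.Percolation
open Summit.CriticalPhenomena.Ising3DConformalLimit.Theses.EnergyNotSigmaSquared
open Summit.CriticalPhenomena.Ising3DConformalLimit.EnergyNotSigmaSquaredGapForcesFarMerging
  (energyFactorisation_criticalCorr pairPairTruncation_le_pairings pairPairTruncation_nonneg)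
open Summit.CriticalPhenomena.Ising3DConformalLimit.PinnedClusterPoints (criticalTwoPoint_pos3)

/-! ### The sourced double current gives every event probability at most one -/

/-- `P^{A,B}_β[S] ≤ 1`: `sourcedDoubleCurrentLawInf` is a probability measure when the weak limit
exists and the zero measure otherwise. [cite: AizenmanDuminilCopinAnnals2021, §3.2] -/
theorem sourcedDoubleCurrentLawInf_real_le_one (β : ℝ) (A B : Finset (Site 3))
    (S : Set (BondConfig (Site 3))) :
    (sourcedDoubleCurrentLawInf 3 β A B).real S ≤ 1 := by
  unfold sourcedDoubleCurrentLawInf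
  split_ifs with h
  · haveI := h.choose_spec.isProbabilityMeasure
    exact measureReal_le_one
  · simp

/-- Hence the avoidance probability `1 - P^{A,B}_β[S]` is nonnegative. [cite: AizenmanDuminilCopinAnnals2021, §3.2] -/
theorem one_sub_sourcedDoubleCurrentLawInf_real_nonneg (β : ℝ) (A B : Finset (Site 3))
    (S : Set (BondConfig (Site 3))) :
    0 ≤ 1 - (sourcedDoubleCurrentLawInf 3 β A B).real S :=
  sub_nonneg.2 (sourcedDoubleCurrentLawInf_real_le_one β A B S)

/-- And at most one. [cite: AizenmanDuminilCopinAnnals2021, §3.2] -/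
theorem one_sub_sourcedDoubleCurrentLawInf_real_le_one (β : ℝ) (A B : Finset (Site 3))
    (S : Set (BondConfig (Site 3))) :
    1 - (sourcedDoubleCurrentLawInf 3 β A B).real S ≤ 1 :=
  sub_le_self _ measureReal_nonneg

/-! ### Two-point comparability at lattice distance one -/

/-- GKS II on pairs: `G(x) G(e₂) ≤ G(x + e₂)` at `β_c` on `ℤ³`. [cite: FriedliVelenik2017, Thm. 3.20, eq. (3.22), p. 109] -/
theorem criticalTwoPoint_mul_e₂_le_add (x : Site 3) :
    criticalTwoPoint 3 x * criticalTwoPoint 3 (Pi.single 1 1) ≤ criticalTwoPoint 3 (x + Pi.single 1 1) := by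
  have h := twoPointPlus_mul_le_twoPointPlus (d := 3) (criticalBeta_nonneg 3) x (x + Pi.single 1 1)
  rwa [add_sub_cancel_left] at h

/-- GKS II on pairs: `G(x) G(e₂) ≤ G(x - e₂)` at `β_c` on `ℤ³`. [cite: FriedliVelenik2017, Thm. 3.20, eq. (3.22), p. 109] -/
theorem criticalTwoPoint_mul_e₂_le_sub (x : Site 3) :
    criticalTwoPoint 3 x * criticalTwoPoint 3 (Pi.single 1 1) ≤ criticalTwoPoint 3 (x - Pi.single 1 1) := by
  have h := twoPointPlus_mul_le_twoPointPlus (d := 3) (criticalBeta_nonneg 3) x (x - Pi.single 1 1)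
  rw [sub_sub_cancel_left] at h
  change criticalTwoPoint 3 x * criticalTwoPoint 3 (-Pi.single 1 1) ≤ criticalTwoPoint 3 (x - Pi.single 1 1) at h
  rwa [criticalTwoPoint_neg] at h

/-- GKS II on pairs: `G(x + e₂) G(e₂) ≤ G(x)` at `β_c` on `ℤ³`. [cite: FriedliVelenik2017, Thm. 3.20, eq. (3.22), p. 109] -/
theorem criticalTwoPoint_add_mul_e₂_le (x : Site 3) :
    criticalTwoPoint 3 (x + Pi.single 1 1) * criticalTwoPoint 3 (Pi.single 1 1) ≤ criticalTwoPoint 3 x := by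
  have h := criticalTwoPoint_mul_e₂_le_sub (x + Pi.single 1 1)
  rwa [add_sub_cancel_right] at h

/-- GKS II on pairs: `G(x - e₂) G(e₂) ≤ G(x)` at `β_c` on `ℤ³`. [cite: FriedliVelenik2017, Thm. 3.20, eq. (3.22), p. 109] -/
theorem criticalTwoPoint_sub_mul_e₂_le (x : Site 3) :
    criticalTwoPoint 3 (x - Pi.single 1 1) * criticalTwoPoint 3 (Pi.single 1 1) ≤ criticalTwoPoint 3 x := by
  have h := criticalTwoPoint_mul_e₂_le_add (x - Pi.single 1 1)
  rwa [sub_add_cancel] at h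

/-- The two-sided comparability of the crossed pairing with `G(x)²`:
`G(e₂)² G(x)² ≤ G(x+e₂) G(x-e₂)` and `G(x+e₂) G(x-e₂) G(e₂)² ≤ G(x)²`. [cite: FriedliVelenik2017, Thm. 3.20, eq. (3.22), p. 109] -/
theorem crossedPairing_comparable (x : Site 3) :
    criticalTwoPoint 3 (Pi.single 1 1) ^ 2 * criticalTwoPoint 3 x ^ 2 ≤
        criticalTwoPoint 3 (x + Pi.single 1 1) * criticalTwoPoint 3 (x - Pi.single 1 1) ∧
      criticalTwoPoint 3 (x + Pi.single 1 1) * criticalTwoPoint 3 (x - Pi.single 1 1) *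
          criticalTwoPoint 3 (Pi.single 1 1) ^ 2 ≤ criticalTwoPoint 3 x ^ 2 := by
  have h0 : ∀ v : Site 3, 0 ≤ criticalTwoPoint 3 v := criticalTwoPoint_nonneg'
  have h1 := criticalTwoPoint_mul_e₂_le_add x
  have h2 := criticalTwoPoint_mul_e₂_le_sub x
  have h3 := criticalTwoPoint_add_mul_e₂_le x
  have h4 := criticalTwoPoint_sub_mul_e₂_le x
  constructor
  · calc criticalTwoPoint 3 (Pi.single 1 1) ^ 2 * criticalTwoPoint 3 x ^ 2
          = (criticalTwoPoint 3 x * criticalTwoPoint 3 (Pi.single 1 1)) *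
              (criticalTwoPoint 3 x * criticalTwoPoint 3 (Pi.single 1 1)) := by ring
      _ ≤ criticalTwoPoint 3 (x + Pi.single 1 1) * criticalTwoPoint 3 (x - Pi.single 1 1) :=
          mul_le_mul h1 h2 (mul_nonneg (h0 _) (h0 _)) (h0 _)
  · calc criticalTwoPoint 3 (x + Pi.single 1 1) * criticalTwoPoint 3 (x - Pi.single 1 1) *
            criticalTwoPoint 3 (Pi.single 1 1) ^ 2
          = (criticalTwoPoint 3 (x + Pi.single 1 1) * criticalTwoPoint 3 (Pi.single 1 1)) *
              (criticalTwoPoint 3 (x - Pi.single 1 1) * criticalTwoPoint 3 (Pi.single 1 1)) := by ring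
      _ ≤ criticalTwoPoint 3 x * criticalTwoPoint 3 x :=
          mul_le_mul h3 h4 (mul_nonneg (h0 _) (h0 _)) (h0 _)
      _ = criticalTwoPoint 3 x ^ 2 := by ring

/-! ### The factorised truncation -/

/-- **Energy factorisation with translation-invariant pair factors**:
`⟨σ₀σ_{e₂}σ_xσ_{x+e₂}⟩ - ⟨σ₀σ_{e₂}⟩⟨σ_xσ_{x+e₂}⟩ = G(x)²·A_par(x) + G(x+e₂)G(x-e₂)·A_cross(x)` at
`β_c` on `ℤ³`. [cite: AizenmanDuminilCopinAnnals2021, eq. (3.11)] -/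
theorem adjacentTruncation_eq (x : Site 3) :
    criticalCorr 3 4 ![0, (Pi.single 1 1 : Site 3), x, x + Pi.single 1 1] -
        criticalCorr 3 2 ![0, (Pi.single 1 1 : Site 3)] * criticalCorr 3 2 ![x, x + Pi.single 1 1] =
      criticalTwoPoint 3 x ^ 2 *
          (1 - (sourcedDoubleCurrentLawInf 3 (criticalBeta 3) ({0} ∆ {x})
            ({(Pi.single 1 1 : Site 3)} ∆ {x + Pi.single 1 1})).real (openConn 0 (Pi.single 1 1))) +
        criticalTwoPoint 3 (x + Pi.single 1 1) * criticalTwoPoint 3 (x - Pi.single 1 1) *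
          (1 - (sourcedDoubleCurrentLawInf 3 (criticalBeta 3) ({0} ∆ {x + Pi.single 1 1})
            ({(Pi.single 1 1 : Site 3)} ∆ {x})).real (openConn 0 (Pi.single 1 1))) := by
  have h := energyFactorisation_criticalCorr 0 (Pi.single 1 1) x (x + Pi.single 1 1)
  rw [criticalCorr_two_pair (0 : Site 3) x, criticalCorr_two_pair (Pi.single 1 1 : Site 3) (x + Pi.single 1 1),
    criticalCorr_two_pair (0 : Site 3) (x + Pi.single 1 1), criticalCorr_two_pair (Pi.single 1 1 : Site 3) x,
    sub_zero, sub_zero, add_sub_cancel_right] at h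
  rw [h]
  ring

/-- **The `κ = 0` envelope** (`EnergyGapSoft` with `ε` frozen): for every `x ∈ ℤ³`,
`0 ≤ ⟨σ₀σ_{e₂} ; σ_xσ_{x+e₂}⟩_{β_c} ≤ (1 + G(e₂)⁻²) ⟨σ₀σ_x⟩²_{β_c}` (GKS II; Lebowitz' inequality and GKS
II on pairs). [cite: Lebowitz1974, Theorem, eq. (2.5b)] -/
theorem adjacentTruncation_le (x : Site 3) :
    0 ≤ criticalCorr 3 4 ![0, (Pi.single 1 1 : Site 3), x, x + Pi.single 1 1] -
        criticalCorr 3 2 ![0, (Pi.single 1 1 : Site 3)] * criticalCorr 3 2 ![x, x + Pi.single 1 1] ∧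
      criticalCorr 3 4 ![0, (Pi.single 1 1 : Site 3), x, x + Pi.single 1 1] -
          criticalCorr 3 2 ![0, (Pi.single 1 1 : Site 3)] * criticalCorr 3 2 ![x, x + Pi.single 1 1] ≤
        (1 + (criticalTwoPoint 3 (Pi.single 1 1) ^ 2)⁻¹) * criticalTwoPoint 3 x ^ 2 := by
  refine ⟨pairPairTruncation_nonneg _ _ _ _, (pairPairTruncation_le_pairings _ _ _ _).trans ?_⟩
  rw [sub_zero, sub_zero, add_sub_cancel_right]
  have hc : 0 < criticalTwoPoint 3 (Pi.single 1 1) ^ 2 := pow_pos (criticalTwoPoint_pos3 _) 2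
  have hcross := (crossedPairing_comparable x).2
  have hle : criticalTwoPoint 3 (x + Pi.single 1 1) * criticalTwoPoint 3 (x - Pi.single 1 1) ≤
      (criticalTwoPoint 3 (Pi.single 1 1) ^ 2)⁻¹ * criticalTwoPoint 3 x ^ 2 := by
    rw [← div_eq_inv_mul, le_div_iff₀ hc]
    exact hcross
  calc criticalTwoPoint 3 x * criticalTwoPoint 3 x +
        criticalTwoPoint 3 (x + Pi.single 1 1) * criticalTwoPoint 3 (x - Pi.single 1 1)
      ≤ criticalTwoPoint 3 x ^ 2 + (criticalTwoPoint 3 (Pi.single 1 1) ^ 2)⁻¹ * criticalTwoPoint 3 x ^ 2 := by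
        rw [← sq]; exact add_le_add le_rfl hle
    _ = (1 + (criticalTwoPoint 3 (Pi.single 1 1) ^ 2)⁻¹) * criticalTwoPoint 3 x ^ 2 := by ring

/-- The `κ = 0` envelope in the shape of the item: there is a constant `C` with
`⟨σ₀σ_{e₂} ; σ_xσ_{x+e₂}⟩_{β_c} ≤ C ⟨σ₀σ_x⟩²_{β_c}` for **all** `x ∈ ℤ³`. [cite: Lebowitz1974, Theorem, eq. (2.5b)] -/
theorem adjacentTruncation_le_const_mul_sq :
    ∃ C : ℝ, ∀ x : Site 3,
      criticalCorr 3 4 ![0, (Pi.single 1 1 : Site 3), x, x + Pi.single 1 1] -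
          criticalCorr 3 2 ![0, (Pi.single 1 1 : Site 3)] * criticalCorr 3 2 ![x, x + Pi.single 1 1] ≤
        C * criticalTwoPoint 3 x ^ 2 :=
  ⟨1 + (criticalTwoPoint 3 (Pi.single 1 1) ^ 2)⁻¹, fun x => (adjacentTruncation_le x).2⟩

/-! ### The reformulation -/

/-- **`EnergyGapSoft` ⟺ adjacent sourced currents merge.** The item holds iff, for both pairings of
the far targets, the probability that two independent critical sourced currents on `ℤ³` with the
adjacent sources `0, e₂` and the adjacent targets `x, x + e₂` do NOT connect `0` to `e₂` in
`n̂₁ ∪ n̂₂` tends to `0` as `‖x‖ → ∞`. [cite: AizenmanDuminilCopinAnnals2021, eq. (3.11)] -/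
theorem energyGapSoft_iff_adjacentMerging :
    EnergyGapSoft ↔
      ∀ ε : ℝ, 0 < ε → ∃ R : ℝ, ∀ x : Site 3, R ≤ ‖x‖ →
        1 - (sourcedDoubleCurrentLawInf 3 (criticalBeta 3) ({0} ∆ {x})
              ({(Pi.single 1 1 : Site 3)} ∆ {x + Pi.single 1 1})).real (openConn 0 (Pi.single 1 1)) ≤ ε ∧
          1 - (sourcedDoubleCurrentLawInf 3 (criticalBeta 3) ({0} ∆ {x + Pi.single 1 1})
              ({(Pi.single 1 1 : Site 3)} ∆ {x})).real (openConn 0 (Pi.single 1 1)) ≤ ε := by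
  -- abbreviations
  set c : ℝ := criticalTwoPoint 3 (Pi.single 1 1) with hc_def
  have hc : 0 < c := criticalTwoPoint_pos3 _
  have hc1 : c ≤ 1 := criticalTwoPoint_le_one' _
  have hG : ∀ x : Site 3, 0 < criticalTwoPoint 3 x := criticalTwoPoint_pos3
  constructor
  · -- `EnergyGapSoft ⟹ merging`
    intro h ε hε
    obtain ⟨R, hR⟩ := h (ε * c ^ 2) (by positivity)
    refine ⟨R, fun x hx => ?_⟩
    have hT := hR x hx
    rw [adjacentTruncation_eq] at hT
    set A₁ := 1 - (sourcedDoubleCurrentLawInf 3 (criticalBeta 3) ({0} ∆ {x})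
      ({(Pi.single 1 1 : Site 3)} ∆ {x + Pi.single 1 1})).real (openConn 0 (Pi.single 1 1)) with hA₁
    set A₂ := 1 - (sourcedDoubleCurrentLawInf 3 (criticalBeta 3) ({0} ∆ {x + Pi.single 1 1})
      ({(Pi.single 1 1 : Site 3)} ∆ {x})).real (openConn 0 (Pi.single 1 1)) with hA₂
    have hA₁0 : 0 ≤ A₁ := one_sub_sourcedDoubleCurrentLawInf_real_nonneg _ _ _ _
    have hA₂0 : 0 ≤ A₂ := one_sub_sourcedDoubleCurrentLawInf_real_nonneg _ _ _ _
    have hGx := hG x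
    have hG2 : 0 < criticalTwoPoint 3 x ^ 2 := pow_pos hGx 2
    have hcross := (crossedPairing_comparable x).1
    have hP0 : 0 ≤ criticalTwoPoint 3 (x + Pi.single 1 1) * criticalTwoPoint 3 (x - Pi.single 1 1) :=
      mul_nonneg (criticalTwoPoint_nonneg' _) (criticalTwoPoint_nonneg' _)
    constructor
    · -- parallel term
      have h1 : criticalTwoPoint 3 x ^ 2 * A₁ ≤ ε * c ^ 2 * criticalTwoPoint 3 x ^ 2 := by
        nlinarith [mul_nonneg hP0 hA₂0]
      have h2 : criticalTwoPoint 3 x ^ 2 * A₁ ≤ criticalTwoPoint 3 x ^ 2 * ε := by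
        calc criticalTwoPoint 3 x ^ 2 * A₁ ≤ ε * c ^ 2 * criticalTwoPoint 3 x ^ 2 := h1
          _ ≤ ε * 1 * criticalTwoPoint 3 x ^ 2 := by gcongr; nlinarith
          _ = criticalTwoPoint 3 x ^ 2 * ε := by ring
      exact le_of_mul_le_mul_left h2 hG2
    · -- crossed term
      have h1 : criticalTwoPoint 3 (x + Pi.single 1 1) * criticalTwoPoint 3 (x - Pi.single 1 1) * A₂ ≤
          ε * c ^ 2 * criticalTwoPoint 3 x ^ 2 := by
        nlinarith [mul_nonneg hG2.le hA₁0]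
      have h2 : c ^ 2 * criticalTwoPoint 3 x ^ 2 * A₂ ≤ c ^ 2 * criticalTwoPoint 3 x ^ 2 * ε := by
        calc c ^ 2 * criticalTwoPoint 3 x ^ 2 * A₂
            ≤ criticalTwoPoint 3 (x + Pi.single 1 1) * criticalTwoPoint 3 (x - Pi.single 1 1) * A₂ :=
              mul_le_mul_of_nonneg_right hcross hA₂0
          _ ≤ ε * c ^ 2 * criticalTwoPoint 3 x ^ 2 := h1
          _ = c ^ 2 * criticalTwoPoint 3 x ^ 2 * ε := by ring
      exact le_of_mul_le_mul_left h2 (by positivity)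
  · -- `merging ⟹ EnergyGapSoft`
    intro h ε hε
    obtain ⟨R, hR⟩ := h (ε * c ^ 2 / 2) (by positivity)
    refine ⟨R, fun x hx => ?_⟩
    obtain ⟨h1, h2⟩ := hR x hx
    rw [adjacentTruncation_eq]
    have hG2 : 0 < criticalTwoPoint 3 x ^ 2 := pow_pos (hG x) 2
    have hcross := (crossedPairing_comparable x).2
    have hP0 : 0 ≤ criticalTwoPoint 3 (x + Pi.single 1 1) * criticalTwoPoint 3 (x - Pi.single 1 1) :=
      mul_nonneg (criticalTwoPoint_nonneg' _) (criticalTwoPoint_nonneg' _)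
    have hPle : criticalTwoPoint 3 (x + Pi.single 1 1) * criticalTwoPoint 3 (x - Pi.single 1 1) ≤
        criticalTwoPoint 3 x ^ 2 / c ^ 2 := by
      rw [le_div_iff₀ (by positivity)]
      exact hcross
    have hA₂0 := one_sub_sourcedDoubleCurrentLawInf_real_nonneg (criticalBeta 3) ({0} ∆ {x + Pi.single 1 1})
      ({(Pi.single 1 1 : Site 3)} ∆ {x}) (openConn 0 (Pi.single 1 1))
    calc criticalTwoPoint 3 x ^ 2 *
            (1 - (sourcedDoubleCurrentLawInf 3 (criticalBeta 3) ({0} ∆ {x})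
              ({(Pi.single 1 1 : Site 3)} ∆ {x + Pi.single 1 1})).real (openConn 0 (Pi.single 1 1))) +
          criticalTwoPoint 3 (x + Pi.single 1 1) * criticalTwoPoint 3 (x - Pi.single 1 1) *
            (1 - (sourcedDoubleCurrentLawInf 3 (criticalBeta 3) ({0} ∆ {x + Pi.single 1 1})
              ({(Pi.single 1 1 : Site 3)} ∆ {x})).real (openConn 0 (Pi.single 1 1)))
        ≤ criticalTwoPoint 3 x ^ 2 * (ε * c ^ 2 / 2) +
            criticalTwoPoint 3 x ^ 2 / c ^ 2 * (ε * c ^ 2 / 2) := by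
          apply add_le_add
          · exact mul_le_mul_of_nonneg_left h1 hG2.le
          · exact mul_le_mul hPle h2 hA₂0 (by positivity)
      _ = ε * criticalTwoPoint 3 x ^ 2 * ((c ^ 2 + 1) / 2) := by
          field_simp
      _ ≤ ε * criticalTwoPoint 3 x ^ 2 * 1 := by
          have h12 : (c ^ 2 + 1) / 2 ≤ 1 := by nlinarith
          exact mul_le_mul_of_nonneg_left h12 (by positivity)
      _ = ε * criticalTwoPoint 3 x ^ 2 := mul_one _

end Summit.CriticalPhenomena.Ising3DConformalLimit.EnergyNotSigmaSquaredEnergyGapSoft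

end
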